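import Mathlib
import Summits.PneNP.PneNP.Theses.SymmetryBudget
import Literature.Computability.Complexity.SymmetricCircuit
import Literature.Computability.Complexity.CircuitRestriction
import Literature.ModelTheory.FiniteModelTheory.SymmetricCircuitCountingWidthProofs
import Summits.PneNP.PneNP.Theorems.SymmetryBudgetPolylogHamCore
import Summits.PneNP.PneNP.Theorems.SymmetryBudgetPolylogHamPathWidth

/-!
# Proof of `SymmetryBudget.PolylogHam` (item stmt-PneNP-2148, route route-PneNP-SymmetryBudget)

**The barrier edge of the symmetry-budget cliff for HAM**: at budget `g = ⌊log₂ m⌋²`, for every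
polynomial `p` there are infinitely many `m` admitting no `Bud(m, g)`-symmetric threshold
circuit of size `≤ p(m)` computing `x ↦ [Gr(x) is Hamiltonian]` (`polylogHam_proof`).

Proof (by contradiction). If from some `m` on such circuits exist, take `m = 2^t`, so that the
free part has `g = t²` vertices and the ordered part `n = 2^t - t²`. HARD-WIRE the ordered part to
the path `0 — ⋯ — (n-1)` with both ends joined to every free vertex
(`SymmetryBudgetPolylogHamCore.exists_hamPlant`): the planted graph is Hamiltonian iff the free
part has a Hamiltonian PATH, and the circuit becomes a `Sym(Fin g)`-symmetric (square-symmetric)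
threshold circuit on `g × g` inputs of size `≤ p(2^t) + 2 = 2^{O(√g)}` deciding "has a Hamiltonian
path" on `g`-vertex graphs, at every large perfect square `g` (a one-gate constant circuit serves
the other orders for the class `𝒞 = {perfect-square order beyond the threshold ∧ Hamiltonian
path}`). The PROVED Dawar–Wilsenach pipeline of the tree — rigidification with supports
(`exists_reduced_rigidification_supports`: `[2, Lemma 7]` + the Support Theorem), the extraction
of `k = o(n)` (`eventually_exists_le_choose_of_subexponential`) and supports-to-`≡^{C^k}`
invariance (`DawarWilsenach2025_countingWidth_littleO_of_supportSize_littleO`), i.e. Theorem 6.4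
of Dawar–Wilsenach 2025 in the form `orbitSize_countingWidth` below (the tree's named fact asks
in addition for simple wiring, which its proof never uses) — then makes `𝒞` `≡^{C^k}`-invariant
on `g`-vertex graphs for all `k ≥ εg`, every `ε > 0`, contradicting the LINEAR counting width of
Hamiltonian path (`SymmetryBudgetPolylogHamPathWidth.hamPath_countingWidth`, the path variant of
Atserias–Dawar–Ochremiak 2021, Lemma 14) at `ε = d/2`.
-/

-- `Summit.PneNP.PneNP.…` duplicates `PneNP` BY DESIGN (single-problem summit).
set_option linter.dupNamespace false

namespace Summit.PneNP.PneNP.Theorems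

open Literature.Computability.Complexity Literature.ModelTheory.FiniteModelTheory Filter Finset
open scoped Classical

namespace PolylogHam

/-! ### Dawar–Wilsenach 2025, Thm. 6.4, for not necessarily simply wired families -/

/-- **Dawar–Wilsenach 2025, Theorem 6.4** (orbit size `2^{o(n)}` ⇒ counting width `o(n)`) for
families of `Sym(Fin n)`-symmetric `tcBasis`-circuits that need NOT be simply wired: the tree's
discharge `DawarWilsenach2025_orbitSize_countingWidth_holds` verbatim (rigidify with supports,
extract `k = o(n)` with `ORB ≤ C(n,k)`, translate supports into `≡^{C^k}`-invariance), whose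
argument does not use the simple-wiring hypothesis of the named fact. -/
theorem orbitSize_countingWidth {𝒞 : Set FinGraph} {C : ∀ n : ℕ, Circuit (Fin n × Fin n)}
    (hC : ∀ n, (C n).IsOver tcBasis ∧ (C n).IsSymmetricUnder Set.univ)
    (hdec : DecidesGraphClass 𝒞 C)
    (horb : ∀ ε : ℝ, 0 < ε →
      ∀ᶠ n : ℕ in atTop, ((C n).orbitSize Set.univ : ℝ) ≤ (2 : ℝ) ^ (ε * (n : ℝ)))
    {ε : ℝ} (hε : 0 < ε) :
    ∀ᶠ n : ℕ in atTop, ∀ k : ℕ, ε * (n : ℝ) ≤ (k : ℝ) → IsCkInvariantAt 𝒞 n k := by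
  choose C' hC' using fun n => exists_reduced_rigidification_supports (C n) (hC n).1 (hC n).2
  have hdec' : DecidesGraphClass 𝒞 C' := by
    intro n G _
    rw [(hC' n).2.2.1]
    exact hdec n G
  have horb' : ∀ δ : ℝ, 0 < δ →
      ∀ᶠ n : ℕ in atTop, ((C' n).orbitSize Set.univ : ℝ) ≤ (2 : ℝ) ^ (δ * (n : ℝ)) := by
    intro δ hδ
    filter_upwards [eventually_add_sq_le_two_rpow horb hδ] with n hn
    exact le_trans (by exact_mod_cast (hC' n).2.2.2.1) hn
  refine DawarWilsenach2025_countingWidth_littleO_of_supportSize_littleO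
    (fun n => ⟨(hC' n).1, (hC' n).2.1⟩) hdec' (fun δ hδ => ?_) hε
  have hδ' : 0 < min δ (1 / 8) := lt_min hδ (by norm_num)
  filter_upwards [eventually_exists_le_choose_of_subexponential horb' hδ', eventually_gt_atTop 8]
    with n hn hn8 j
  obtain ⟨k, hk1, -, hkδ, hks⟩ := hn
  have hkδn : (k : ℝ) ≤ δ * n :=
    hkδ.trans (mul_le_mul_of_nonneg_right (min_le_left _ _) (Nat.cast_nonneg n))
  have h8k : 8 * k ≤ n := by
    have h : (8 : ℝ) * k ≤ n := by
      have := hkδ.trans (mul_le_mul_of_nonneg_right (min_le_right _ _) (Nat.cast_nonneg n))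
      linarith
    exact_mod_cast h
  have hk4 : k + 1 ≤ n / 4 := (Nat.le_div_iff_mul_le (by norm_num)).2 (by omega)
  obtain ⟨S, hS, hsup⟩ := (hC' n).2.2.2.2 hn8 k hk1 hk4 hks j
  exact ⟨S, le_trans (by exact_mod_cast hS) hkδn, hsup⟩

/-! ### The constant circuit -/

/-- The one-gate constant-`false` circuit is a `tcBasis`-circuit (`∨₀ = GateFn.const false`),
symmetric under every permutation (the identity on its gate is an automorphism: no arguments, the
output gate is fixed), of size `1`, with value `false`. -/
theorem const_false_spec (g : ℕ) :
    (Circuit.const (Fin g × Fin g) false).IsOver tcBasis ∧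
      (Circuit.const (Fin g × Fin g) false).IsSymmetricUnder Set.univ ∧
      (Circuit.const (Fin g × Fin g) false).size = 1 ∧
      ∀ x, (Circuit.const (Fin g × Fin g) false).eval x = false := by
  refine ⟨?_, ?_, rfl, fun x => rfl⟩
  · intro gt hgt
    simp only [Circuit.const, List.mem_singleton] at hgt
    subst hgt
    exact acBasis_subset_tcBasis (const_mem_acBasis false)
  · intro ρ _
    refine ⟨1, ?_, ?_⟩
    · show Sum.inr (Circuit.relabelGate (1 : Equiv.Perm (Fin 1)) 0) = Sum.inr 0
      rw [Circuit.relabelGate_of_lt _ Nat.one_pos]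
      rfl
    · intro j
      obtain ⟨j, hj⟩ := j
      have hj0 : j = 0 := by
        simp only [Circuit.const, List.length_singleton] at hj
        omega
      subst hj0
      exact ⟨rfl, by simp [Circuit.const]⟩

end PolylogHam

/-! ### The theorem -/

open PolylogHam in
/-- **`PolylogHam` (item stmt-PneNP-2148): at budget `g = ⌊log₂ m⌋²`, for every polynomial `p`
there are infinitely many `m` with no `Bud(m, g)`-symmetric threshold (`tcBasis`) circuit of size
`≤ p(m)` computing `x ↦ [Gr(x) is Hamiltonian]`.** Proof: module docstring (planting a
Hamiltonian-path instance on the free part at `m = 2^t`, the Dawar–Wilsenach support-theorem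
pipeline for the resulting square-symmetric circuits of size `2^{O(√g)}`, and the linear counting
width of Hamiltonian path). -/
theorem polylogHam_proof : Summit.PneNP.PneNP.Theses.SymmetryBudget.PolylogHam := by
  show ∀ p : Polynomial ℕ, ∃ᶠ m in atTop, ¬ HasSymCircuit tcBasis
    (pointStabiliserBudget m (Nat.log 2 m ^ 2)) (p.eval m)
    (fun x : Fin m × Fin m → Bool =>
      decide (SimpleGraph.fromRel fun u v => x (u, v) = true).IsHamiltonian)
  intro p
  by_contra hcon
  rw [Filter.not_frequently] at hcon
  simp only [not_not] at hcon
  obtain ⟨M₀, hM₀⟩ := Filter.eventually_atTop.1 hcon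
  obtain ⟨d, g₀, hd⟩ := CoreReduction.exists_pow_bound p
  -- the threshold `t₀` on `t` (where `m = 2^t`, `g = t²`, `n = 2^t - t²`)
  obtain ⟨t₀, ht₀⟩ : ∃ t₀ : ℕ, ∀ t, t₀ ≤ t → M₀ ≤ 2 ^ t ∧ g₀ ≤ t ∧ t ^ 2 + 3 ≤ 2 ^ t ∧ 1 ≤ t := by
    have h1 : ∀ᶠ t : ℕ in atTop, M₀ ≤ 2 ^ t :=
      (tendsto_pow_atTop_atTop_of_one_lt one_lt_two).eventually_ge_atTop M₀
    have h2 : ∀ᶠ t : ℕ in atTop, t ^ 2 + 3 ≤ 2 ^ t := by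
      -- `t² + 3 ≤ 2^t` for `t ≥ 5`
      refine Filter.eventually_atTop.2 ⟨5, fun t ht => ?_⟩
      obtain ⟨s, rfl⟩ : ∃ s, t = s + 5 := ⟨t - 5, by omega⟩
      clear ht
      induction s with
      | zero => norm_num
      | succ s ih =>
        have : (s + 1 + 5) ^ 2 + 3 ≤ 2 * ((s + 5) ^ 2 + 3) := by nlinarith
        calc (s + 1 + 5) ^ 2 + 3 ≤ 2 * ((s + 5) ^ 2 + 3) := this
          _ ≤ 2 * 2 ^ (s + 5) := Nat.mul_le_mul_left _ ih
          _ = 2 ^ (s + 1 + 5) := by ring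
    obtain ⟨t₀, ht₀⟩ := Filter.eventually_atTop.1 (h1.and (h2.and
      ((eventually_ge_atTop g₀).and (eventually_ge_atTop 1))))
    exact ⟨t₀, fun t ht => ⟨(ht₀ t ht).1, (ht₀ t ht).2.2.1, (ht₀ t ht).2.1, (ht₀ t ht).2.2.2⟩⟩
  -- good orders: perfect squares `g = t²`, `t ≥ t₀`; the class `𝒞`
  let Good : ℕ → Prop := fun g => ∃ t, t₀ ≤ t ∧ g = t ^ 2
  let 𝒞 : Set FinGraph := {A | Good A.1 ∧
    ∃ l : List (Fin A.1), l.Nodup ∧ (∀ v, v ∈ l) ∧ List.IsChain A.2.Adj l}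
  -- at a good order, a square-symmetric circuit of size `≤ p(2^t) + 2` decides Hamiltonian path
  have hgood : ∀ t, t₀ ≤ t → ∃ D : Circuit (Fin (t ^ 2) × Fin (t ^ 2)), D.IsOver tcBasis ∧
      D.IsSymmetricUnder Set.univ ∧ D.size ≤ 2 ^ (d * t) ∧
      ∀ G : SimpleGraph (Fin (t ^ 2)), D.eval (fun q => decide (G.Adj q.1 q.2)) = true ↔
        ∃ l : List (Fin (t ^ 2)), l.Nodup ∧ (∀ v, v ∈ l) ∧ List.IsChain G.Adj l := by
    intro t ht
    obtain ⟨hM, hg₀, hsq, ht1⟩ := ht₀ t ht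
    set n : ℕ := 2 ^ t - t ^ 2 with hn
    have hm : n + t ^ 2 = 2 ^ t := by omega
    have hlog : Nat.log 2 (n + t ^ 2) = t := by rw [hm, Nat.log_pow (by norm_num)]
    obtain ⟨C, hB, hsize, hsym, hcomp⟩ := hM₀ (n + t ^ 2) (by omega)
    rw [hlog] at hsym
    obtain ⟨P, hPham, hPcirc⟩ := exists_hamPlant n (t ^ 2) (by omega) (by nlinarith)
    obtain ⟨D, hDB, hDs, hDsym, hDev⟩ := hPcirc C hB hsym
    refine ⟨D, hDB, hDsym, ?_, fun G => ?_⟩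
    · rw [hDs]
      have := hd t hg₀
      rw [← hm] at this
      omega
    · rw [hDev G, hcomp (P G), decide_eq_true_eq]
      exact hPham G
  -- the family over all orders
  have key : ∀ g : ℕ, ∃ D : Circuit (Fin g × Fin g), D.IsOver tcBasis ∧
      D.IsSymmetricUnder Set.univ ∧
      (D.size ≤ if h : Good g then 2 ^ (d * Nat.sqrt g) else 1) ∧
      ∀ G : SimpleGraph (Fin g), D.eval (fun q => decide (G.Adj q.1 q.2)) = true ↔
        (⟨g, G⟩ : FinGraph) ∈ 𝒞 := by
    intro g
    by_cases hg : Good g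
    · obtain ⟨t, ht, rfl⟩ := hg
      obtain ⟨D, hDB, hDsym, hDs, hDev⟩ := hgood t ht
      refine ⟨D, hDB, hDsym, ?_, fun G => ?_⟩
      · rw [dif_pos ⟨t, ht, rfl⟩, Nat.sqrt_eq']
        exact hDs
      · rw [hDev G]
        exact ⟨fun h => ⟨⟨t, ht, rfl⟩, h⟩, fun h => h.2⟩
    · obtain ⟨hB, hsym, hs, hev⟩ := const_false_spec g
      refine ⟨Circuit.const (Fin g × Fin g) false, hB, hsym, ?_, fun G => ?_⟩
      · rw [dif_neg hg, hs]
      · rw [hev]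
        simp only [Bool.false_eq_true, false_iff]
        exact fun h => hg h.1
  choose C hCB hCsym hCsize hCdec using key
  have hdec : DecidesGraphClass 𝒞 C := fun g G _ => by
    convert hCdec g G with q
    exact decide_eq_decide.2 Iff.rfl
  -- orbit size `2^{o(g)}`: `≤ 2^{d √g}` at good orders, `≤ 1` elsewhere
  have horb : ∀ ε : ℝ, 0 < ε →
      ∀ᶠ g : ℕ in atTop, ((C g).orbitSize Set.univ : ℝ) ≤ (2 : ℝ) ^ (ε * (g : ℝ)) := by
    intro ε hε
    filter_upwards [eventually_ge_atTop ⌈(d / ε) ^ 2⌉₊] with g hg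
    have hsize : ((C g).orbitSize Set.univ : ℝ) ≤ (C g).size := by
      exact_mod_cast (C g).orbitSize_le_size Set.univ
    refine hsize.trans ?_
    have h1 : (1 : ℝ) ≤ (2 : ℝ) ^ (ε * (g : ℝ)) := Real.one_le_rpow (by norm_num) (by positivity)
    by_cases hG : Good g
    · obtain ⟨t, ht₀t, rfl⟩ := hG
      have hs := hCsize (t ^ 2)
      rw [dif_pos ⟨t, ht₀t, rfl⟩, Nat.sqrt_eq'] at hs
      -- `d t ≤ ε t²` since `t ≥ d/ε`
      have ht : d / ε ≤ t := by
        have hg' : ((d / ε) ^ 2 : ℝ) ≤ ((t ^ 2 : ℕ) : ℝ) := (Nat.le_ceil _).trans (by exact_mod_cast hg)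
        push_cast at hg'
        nlinarith [div_nonneg (Nat.cast_nonneg d) hε.le, sq_nonneg ((d : ℝ) / ε - t)]
      have hexp : ((d * t : ℕ) : ℝ) ≤ ε * ((t ^ 2 : ℕ) : ℝ) := by
        rw [div_le_iff₀ hε] at ht
        push_cast
        nlinarith
      calc ((C (t ^ 2)).size : ℝ) ≤ ((2 ^ (d * t) : ℕ) : ℝ) := by exact_mod_cast hs
        _ = (2 : ℝ) ^ ((d * t : ℕ) : ℝ) := by rw [Real.rpow_natCast]; push_cast; ring
        _ ≤ (2 : ℝ) ^ (ε * ((t ^ 2 : ℕ) : ℝ)) :=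
            Real.rpow_le_rpow_of_exponent_le (by norm_num) hexp
    · have hs := hCsize g
      rw [dif_neg hG] at hs
      calc ((C g).size : ℝ) ≤ 1 := by exact_mod_cast hs
        _ ≤ (2 : ℝ) ^ (ε * (g : ℝ)) := h1
  -- counting width `o(g)` of `𝒞` versus linear counting width of Hamiltonian path
  obtain ⟨d₁, hd₁, hpath⟩ := hamPath_countingWidth
  have hinv := orbitSize_countingWidth (fun g => ⟨hCB g, hCsym g⟩) hdec horb (half_pos hd₁)
  obtain ⟨N₁, hN₁⟩ := Filter.eventually_atTop.1 (hinv.and (hpath.and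
    (tendsto_natCast_atTop_atTop.eventually_ge_atTop (4 / d₁))))
  -- a good order beyond `N₁`
  obtain ⟨t, ht₀t, hN₁t⟩ : ∃ t, t₀ ≤ t ∧ N₁ ≤ t ^ 2 :=
    ⟨max t₀ N₁, le_max_left _ _, (le_max_right _ _).trans (Nat.le_self_pow two_ne_zero _)⟩
  obtain ⟨hinv_g, hpath_g, hbig⟩ := hN₁ (t ^ 2) hN₁t
  set g : ℕ := t ^ 2 with hg
  set k : ℕ := ⌈d₁ / 2 * (g : ℝ)⌉₊ with hk
  have hkge : d₁ / 2 * (g : ℝ) ≤ k := Nat.le_ceil _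
  have hklt : (k : ℝ) < d₁ / 2 * g + 1 := Nat.ceil_lt_add_one (by positivity)
  have hIk : IsCkInvariantAt 𝒞 g k := hinv_g k hkge
  have hdg : d₁ * (g : ℝ) ≤ k := by
    refine hpath_g k fun G H hGH => ?_
    have := hIk G H hGH
    simp only [𝒞, Set.mem_setOf_eq] at this
    have hG : Good g := ⟨t, ht₀t, rfl⟩
    simpa [hG] using this
  have h4 : (4 : ℝ) ≤ d₁ * g := by
    rw [div_le_iff₀ hd₁] at hbig
    linarith
  linarith

end Summit.PneNP.PneNP.Theorems
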